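import Mathlib
import HarnessLib
import Summits.FinalStateConjecture.Statement
import Literature.Geometry.Lorentzian.KerrData
import Literature.Geometry.Lorentzian.TameGenericityDiagonal
import Literature.Geometry.Lorentzian.ExactKerrEnd

/-!
# `ExactKerrEnds.SettlingAlongCensoredKerrEnds` (stmt-FinalStateConjecture-18520) ⇐ GU ∧ PW — the
# Theses-free hypothesis form of line `wall-cone-sections` (crux-strategist s2, 2026-08-17)

`settlingAlongCensoredKerrEnds_of_gaugeUpgrade_of_walls (hGU : GU) (hPW : PW) : <crux body verbatim>`:
the gauge-borne upgrade GU (settled tame curves need neither injectivity nor immersion) and the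
Lipschitz-walls statement PW (finitely many `K`-Lipschitz exceptional walls through the corner of a
one-sided kick-unfolding of the given censored Kerr-ended curve) imply the crux: the cone ray
`s = (K + 1) t` over the walls, run by the even corner reparametrisation `t = t₂ c²/(1 + c²)`, is a
tame admissible curve through `F 0` with settled members off `0`; GU makes it injective and immersed.
Sorry-free; does NOT import the route file (the conclusion is the body of
`Theses.ExactKerrEnds.SettlingAlongCensoredKerrEnds` verbatim, so a prover may land it under
`Theorems/` with `--supports stmt-FinalStateConjecture-18520`, and a planner may then file
`route edit --split SettlingAlongCensoredKerrEnds --into GaugeBorneUpgrade LipschitzWallsInKickUnfolding --glue-by <this decl>`).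
Skeleton (stubs registered additively): `Cruxes/SettlingAlongCensoredKerrEnds/Lines/wall_cone_sections.lean`.
-/

noncomputable section

set_option linter.dupNamespace false

open Set Function Filter Topology TopologicalSpace
open scoped ENNReal NNReal Topology Manifold ContDiff
open Literature.Geometry.Lorentzian

namespace Summit.FinalStateConjecture.FinalStateConjecture.Cruxes.SettlingAlongCensoredKerrEnds.WallConeSectionsSplit

/-! ### The cone ray over Lipschitz walls (proved real analysis) -/

/-- The even corner reparametrisation `x ↦ t₂ · x² / (1 + x²)`: smooth, `0` at `0`, values in
`(0, t₂)` off `0` (for `t₂ > 0`). -/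
def cornerParam (t₂ x : ℝ) : ℝ := t₂ * (x ^ 2 / (1 + x ^ 2))

theorem contDiff_cornerParam (t₂ : ℝ) : ContDiff ℝ ∞ (cornerParam t₂) := by
  unfold cornerParam
  refine contDiff_const.mul (ContDiff.div (contDiff_id.pow 2) (contDiff_const.add (contDiff_id.pow 2)) ?_)
  intro x
  positivity

theorem cornerParam_zero (t₂ : ℝ) : cornerParam t₂ 0 = 0 := by simp [cornerParam]

theorem cornerParam_pos {t₂ x : ℝ} (ht₂ : 0 < t₂) (hx : x ≠ 0) : 0 < cornerParam t₂ x := by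
  unfold cornerParam
  have hx2 : 0 < x ^ 2 := by positivity
  positivity

theorem cornerParam_lt {t₂ : ℝ} (ht₂ : 0 < t₂) (x : ℝ) : cornerParam t₂ x < t₂ := by
  unfold cornerParam
  have h1 : x ^ 2 / (1 + x ^ 2) < 1 := by
    rw [div_lt_one (by positivity)]
    linarith [sq_nonneg x]
  calc t₂ * (x ^ 2 / (1 + x ^ 2)) < t₂ * 1 := by exact mul_lt_mul_of_pos_left h1 ht₂
    _ = t₂ := mul_one t₂

/-- **Off the walls along the cone ray.** A `K`-Lipschitz function through the origin satisfies
`g t < (K + 1) t` for `t > 0`; so the ray `s = (K + 1) t` misses every such wall. -/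
theorem ray_ne_wall {K : ℝ≥0} {g : ℝ → ℝ} (hg : LipschitzWith K g) (hg0 : g 0 = 0) {t : ℝ}
    (ht : 0 < t) : ((K : ℝ) + 1) * t ≠ g t := by
  have h := hg.dist_le_mul t 0
  rw [hg0, Real.dist_eq, Real.dist_eq, sub_zero, sub_zero, abs_of_pos ht] at h
  have h' : g t ≤ (K : ℝ) * t := le_trans (le_abs_self _) h
  intro heq
  have : ((K : ℝ) + 1) * t ≤ (K : ℝ) * t := heq ▸ h'
  nlinarith

/-! ### The hypothesis form (proved, Theses-free) -/

/-- **`SettlingAlongCensoredKerrEnds` from the gauge-borne upgrade (GU) and the Lipschitz walls (PW).**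
Conclusion = the body of `Theses.ExactKerrEnds.SettlingAlongCensoredKerrEnds`, verbatim. -/
theorem settlingAlongCensoredKerrEnds_of_gaugeUpgrade_of_walls
    (hGU :
    ∀ (X : Type) [TopologicalSpace X] [ChartedSpace E3 X] [IsManifold (𝓡 3) ∞ X] [T2Space X]
      [SecondCountableTopology X] [ConnectedSpace X],
      ∀ (e : AFEnd X) (H : EuclideanSpace ℝ (Fin 1) → InitialDataSet (𝓡 3) X),
        InitialDataSet.IsTameDataFamily e 1 H →
          (∀ c, H c ∈ admissibleVacuumData X) →
            (∀ c ≠ 0, ∀ 𝒟 : VacuumCauchyDevelopment (H c), 𝒟.IsMaximal →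
              Summit.FinalStateConjecture.HasCompleteNullInfinity 𝒟.toCauchyDevelopment ∧
                ∃ (O : Set 𝒟.carrier) (d : FinalStateDecomposition 𝒟.toSpacetime O 2),
                  (∀ i, Kerr.IsSubextremal (d.mass i) (d.spin i)) ∧
                    O = Summit.FinalStateConjecture.exteriorOf 𝒟.toCauchyDevelopment d.charted ∧
                      Summit.FinalStateConjecture.RaysStayInClosure 𝒟.toCauchyDevelopment O ∧
                        Summit.FinalStateConjecture.HasExhaustiveCharts d ∧
                          Summit.FinalStateConjecture.IsFutureOriented d) →
              ∃ (e' : AFEnd X) (F' : EuclideanSpace ℝ (Fin 1) → InitialDataSet (𝓡 3) X),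
                InitialDataSet.IsTameDataFamily e' 1 F' ∧ F' 0 = H 0 ∧ Injective F' ∧
                  InitialDataSet.IsImmersedAtZero 1 F' ∧ (∀ c, F' c ∈ admissibleVacuumData X) ∧
                    ∀ c ≠ 0, ∀ 𝒟 : VacuumCauchyDevelopment (F' c), 𝒟.IsMaximal →
                      Summit.FinalStateConjecture.HasCompleteNullInfinity 𝒟.toCauchyDevelopment ∧
                        ∃ (O : Set 𝒟.carrier) (d : FinalStateDecomposition 𝒟.toSpacetime O 2),
                          (∀ i, Kerr.IsSubextremal (d.mass i) (d.spin i)) ∧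
                            O = Summit.FinalStateConjecture.exteriorOf 𝒟.toCauchyDevelopment
                                  d.charted ∧
                              Summit.FinalStateConjecture.RaysStayInClosure 𝒟.toCauchyDevelopment O ∧
                                Summit.FinalStateConjecture.HasExhaustiveCharts d ∧
                                  Summit.FinalStateConjecture.IsFutureOriented d)
    (hPW :
    ∀ (X : Type) [TopologicalSpace X] [ChartedSpace E3 X] [IsManifold (𝓡 3) ∞ X] [T2Space X]
      [SecondCountableTopology X] [ConnectedSpace X],
      ∀ (e : AFEnd X) (F : EuclideanSpace ℝ (Fin 1) → InitialDataSet (𝓡 3) X),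
        InitialDataSet.IsTameDataFamily e 1 F →
          ((InitialDataSet.IsImmersedAtZero 1 F ∧ Injective F) ∨ ∀ c, F c = F 0) →
            (∀ c, F c ∈ admissibleVacuumData X) →
              (∀ c ≠ 0, (F c).HasExactKerrEnd ∧
                ∀ 𝒟 : VacuumCauchyDevelopment (F c), 𝒟.IsMaximal →
                  Summit.FinalStateConjecture.HasCompleteNullInfinity 𝒟.toCauchyDevelopment) →
                ∃ (e' : AFEnd X) (G : EuclideanSpace ℝ (Fin 2) → InitialDataSet (𝓡 3) X)
                  (n : ℕ) (g : Fin n → ℝ → ℝ) (K : ℝ≥0) (t₁ b₀ : ℝ),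
                  InitialDataSet.IsTameDataFamily e' 2 G ∧
                    (∀ c : EuclideanSpace ℝ (Fin 1),
                      G ((c 0) • EuclideanSpace.single 0 (1 : ℝ) +
                          (0 : ℝ) • EuclideanSpace.single 1 (1 : ℝ)) = F c) ∧
                    (∀ p, G p ∈ admissibleVacuumData X) ∧
                    (∀ i, LipschitzWith K (g i)) ∧ (∀ i, g i 0 = 0) ∧ 0 < t₁ ∧ 0 < b₀ ∧
                    ∀ t ∈ Ioc (0 : ℝ) t₁, ∀ s : ℝ, 0 < s → s < b₀ → (∀ i, s ≠ g i t) →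
                      ∀ 𝒟 : VacuumCauchyDevelopment
                          (G (t • EuclideanSpace.single 0 (1 : ℝ) + s • EuclideanSpace.single 1 (1 : ℝ))),
                        𝒟.IsMaximal →
                          Summit.FinalStateConjecture.HasCompleteNullInfinity 𝒟.toCauchyDevelopment ∧
                            ∃ (O : Set 𝒟.carrier) (d : FinalStateDecomposition 𝒟.toSpacetime O 2),
                              (∀ i, Kerr.IsSubextremal (d.mass i) (d.spin i)) ∧
                                O = Summit.FinalStateConjecture.exteriorOf 𝒟.toCauchyDevelopment
                                      d.charted ∧
                                  Summit.FinalStateConjecture.RaysStayInClosure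
                                      𝒟.toCauchyDevelopment O ∧
                                    Summit.FinalStateConjecture.HasExhaustiveCharts d ∧
                                      Summit.FinalStateConjecture.IsFutureOriented d) :
    ∀ (X : Type) [TopologicalSpace X] [ChartedSpace Literature.Geometry.Lorentzian.E3 X] [IsManifold (𝓡 3) ((⊤ : ℕ∞) : WithTop ℕ∞) X] [T2Space X] [SecondCountableTopology X] [ConnectedSpace X], let KerrEnded : Literature.Geometry.Lorentzian.InitialDataSet (𝓡 3) X → Prop := fun D ↦ ∀ [Literature.Geometry.Lorentzian.Kerr.Facts], ∃ (K : Set X) (U : Opens Literature.Geometry.Lorentzian.E3) (M a r₀ : ℝ) (hM : 0 ≤ M) (φ : U → X) (ψ : U → Literature.Geometry.Lorentzian.Kerr.region a r₀) (ν : Literature.Geometry.Lorentzian.NormalField 𝓘(ℝ, Literature.Geometry.Lorentzian.E4) ψ), IsCompact K ∧ Kᶜ ⊆ range φ ∧ Topology.IsOpenEmbedding φ ∧ ContMDiff 𝓘(ℝ, Literature.Geometry.Lorentzian.E3) (𝓡 3) ((⊤ : ℕ∞) : WithTop ℕ∞) φ ∧ Injective ψ ∧ (Literature.Geometry.Lorentzian.Kerr.smoothMetric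 M a r₀).IsSpacelikeImmersion 𝓘(ℝ, Literature.Geometry.Lorentzian.E3) ψ ∧ (Literature.Geometry.Lorentzian.Kerr.smoothMetric M a r₀).IsFutureUnitNormal 𝓘(ℝ, Literature.Geometry.Lorentzian.E3) ((Literature.Geometry.Lorentzian.Kerr.timeOrientation M a r₀ hM).ofLE le_top) ψ ν ∧ (∀ (y : U) (v w : Literature.Geometry.Lorentzian.E3), φ y ∉ K → D.h.inner (φ y) (mfderiv 𝓘(ℝ, Literature.Geometry.Lorentzian.E3) (𝓡 3) φ y v) (mfderiv 𝓘(ℝ, Literature.Geometry.Lorentzian.E3) (𝓡 3) φ y w) = Literature.Geometry.Lorentzian.Kerr.bilin M a (ψ y : Literature.Geometry.Lorentzian.E4) (mfderiv 𝓘(ℝ, Literature.Geometry.Lorentzian.E3) 𝓘(ℝ, Literature.Geometry.Lorentzian.E4) ψ y v) (mfderiv 𝓘(ℝ, Literature.Geometry.Lorentzian.E3) 𝓘(ℝ, Literature.Geometry.Lorentzian.E4) ψ y w)) ∧ (∀ [(Literature.Geometry.Lorentzian.Kerr.smoothMetric M a r₀).HasLeviCivita] (y : U) (v w : Literature.Geometry.Lorentzian.E3),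 φ y ∉ K → D.k (φ y) (mfderiv 𝓘(ℝ, Literature.Geometry.Lorentzian.E3) (𝓡 3) φ y v) (mfderiv 𝓘(ℝ, Literature.Geometry.Lorentzian.E3) (𝓡 3) φ y w) = (Literature.Geometry.Lorentzian.Kerr.smoothMetric M a r₀).secondFundamentalForm 𝓘(ℝ, Literature.Geometry.Lorentzian.E3) ψ ν y v w); let Censored : Literature.Geometry.Lorentzian.InitialDataSet (𝓡 3) X → Prop := fun D ↦ ∀ 𝒟 : Literature.Geometry.Lorentzian.VacuumCauchyDevelopment D, 𝒟.IsMaximal → Summit.FinalStateConjecture.HasCompleteNullInfinity 𝒟.toCauchyDevelopment; let Settled : Literature.Geometry.Lorentzian.InitialDataSet (𝓡 3) X → Prop := fun D ↦ ∀ 𝒟 : Literature.Geometry.Lorentzian.VacuumCauchyDevelopment D, 𝒟.IsMaximal → Summit.FinalStateConjecture.HasCompleteNullInfinity 𝒟.toCauchyDevelopment ∧ ∃ (O : Set 𝒟.carrier) (d : Literature.Geometry.Lorentzian.FinalStateDecomposition 𝒟.toSpacetime O 2), (∀ i, Literature.Geometry.Lorentzian.Kerr.IsSubextremal (d.mass i)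 (d.spin i)) ∧ O = Summit.FinalStateConjecture.exteriorOf 𝒟.toCauchyDevelopment d.charted ∧ Summit.FinalStateConjecture.RaysStayInClosure 𝒟.toCauchyDevelopment O ∧ Summit.FinalStateConjecture.HasExhaustiveCharts d ∧ Summit.FinalStateConjecture.IsFutureOriented d; ∀ (e : Literature.Geometry.Lorentzian.AFEnd X) (F : EuclideanSpace ℝ (Fin 1) → Literature.Geometry.Lorentzian.InitialDataSet (𝓡 3) X), Literature.Geometry.Lorentzian.InitialDataSet.IsTameDataFamily e 1 F → ((Literature.Geometry.Lorentzian.InitialDataSet.IsImmersedAtZero 1 F ∧ Injective F) ∨ ∀ c, F c = F 0) → (∀ c, F c ∈ Literature.Geometry.Lorentzian.admissibleVacuumData X) → (∀ c ≠ 0, KerrEnded (F c) ∧ Censored (F c)) → ∃ (e' : Literature.Geometry.Lorentzian.AFEnd X) (F' : EuclideanSpace ℝ (Fin 1) → Literature.Geometry.Lorentzian.InitialDataSet (𝓡 3) X), Literature.Geometry.Lorentzian.InitialDataSet.IsTameDataFamily e' 1 F' ∧ F' 0 = F 0 ∧ Injective F' ∧ Literature.Geometry.Lorentzian.InitialDataSet.IsImmersedAtZero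 1 F' ∧ (∀ c, F' c ∈ Literature.Geometry.Lorentzian.admissibleVacuumData X) ∧ ∀ c ≠ 0, Settled (F' c) := by
  intro X _ _ _ _ _ _ KerrEnded Censored Settled e F hF hdich h𝓓 hQ
  -- the members off `0` of `F` are Kerr-ended (legend = `HasExactKerrEnd`, definitionally) and censored
  have hQ' : ∀ c ≠ 0, (F c).HasExactKerrEnd ∧
      ∀ 𝒟 : VacuumCauchyDevelopment (F c), 𝒟.IsMaximal →
        Summit.FinalStateConjecture.HasCompleteNullInfinity 𝒟.toCauchyDevelopment := fun c hc ↦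
    ⟨(InitialDataSet.hasExactKerrEnd_iff (F c)).2 (hQ c hc).1, (hQ c hc).2⟩
  -- PW: the unfolding, the walls, the box
  obtain ⟨e', G, n, g, K, t₁, b₀, hG, hGF, hGadm, hg, hg0, ht₁, hb₀, hgood⟩ :=
    hPW X e F hF hdich h𝓓 hQ'
  -- the cone ray `s = (K+1) t`, `t = t₂ x²/(1+x²)`
  set κ : ℝ := (K : ℝ) + 1 with hκ
  have hκpos : 0 < κ := by rw [hκ]; positivity
  set t₂ : ℝ := min t₁ (b₀ / (2 * κ)) with ht₂
  have ht₂pos : 0 < t₂ := lt_min ht₁ (by positivity)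
  have ht₂le : t₂ ≤ t₁ := min_le_left _ _
  have ht₂b : κ * t₂ ≤ b₀ / 2 := by
    have : t₂ ≤ b₀ / (2 * κ) := min_le_right _ _
    calc κ * t₂ ≤ κ * (b₀ / (2 * κ)) := by exact mul_le_mul_of_nonneg_left this hκpos.le
      _ = b₀ / 2 := by field_simp
  let ray : EuclideanSpace ℝ (Fin 1) → EuclideanSpace ℝ (Fin 2) := fun c ↦
    (cornerParam t₂ (c 0)) • EuclideanSpace.single 0 (1 : ℝ) +
      (κ * cornerParam t₂ (c 0)) • EuclideanSpace.single 1 (1 : ℝ)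
  have h0 : ContDiff ℝ ∞ (fun c : EuclideanSpace ℝ (Fin 1) ↦ c 0) :=
    (EuclideanSpace.proj (0 : Fin 1) : EuclideanSpace ℝ (Fin 1) →L[ℝ] ℝ).contDiff
  have hφ : ContDiff ℝ ∞ (fun c : EuclideanSpace ℝ (Fin 1) ↦ cornerParam t₂ (c 0)) :=
    (contDiff_cornerParam t₂).comp h0
  have hray : ContDiff ℝ ∞ ray := (hφ.smul contDiff_const).add ((contDiff_const.mul hφ).smul contDiff_const)
  have hray0 : ray 0 = 0 := by
    simp [ray, cornerParam_zero]
  -- the handed-over (not yet immersed) curve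
  let H : EuclideanSpace ℝ (Fin 1) → InitialDataSet (𝓡 3) X := fun c ↦ G (ray c)
  have hH : InitialDataSet.IsTameDataFamily e' 1 H := hG.comp_contDiff hray hray0
  have hH0 : H 0 = F 0 := by
    have h1 : H 0 = G 0 := by simp only [H, hray0]
    have h2 := hGF 0
    have h3 : ((0 : EuclideanSpace ℝ (Fin 1)) 0) • EuclideanSpace.single (0 : Fin 2) (1 : ℝ) +
        (0 : ℝ) • EuclideanSpace.single (1 : Fin 2) (1 : ℝ) = 0 := by simp
    rw [h3] at h2
    exact h1.trans h2
  have hHadm : ∀ c, H c ∈ admissibleVacuumData X := fun c ↦ hGadm _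
  have hHgood : ∀ c ≠ 0, ∀ 𝒟 : VacuumCauchyDevelopment (H c), 𝒟.IsMaximal →
      Summit.FinalStateConjecture.HasCompleteNullInfinity 𝒟.toCauchyDevelopment ∧
        ∃ (O : Set 𝒟.carrier) (d : FinalStateDecomposition 𝒟.toSpacetime O 2),
          (∀ i, Kerr.IsSubextremal (d.mass i) (d.spin i)) ∧
            O = Summit.FinalStateConjecture.exteriorOf 𝒟.toCauchyDevelopment d.charted ∧
              Summit.FinalStateConjecture.RaysStayInClosure 𝒟.toCauchyDevelopment O ∧
                Summit.FinalStateConjecture.HasExhaustiveCharts d ∧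
                  Summit.FinalStateConjecture.IsFutureOriented d := by
    intro c hc
    have hc0 : c 0 ≠ 0 := by
      intro h
      apply hc
      ext i
      rw [Subsingleton.elim i 0, h]
      rfl
    have htpos : 0 < cornerParam t₂ (c 0) := cornerParam_pos ht₂pos hc0
    have htlt : cornerParam t₂ (c 0) < t₂ := cornerParam_lt ht₂pos (c 0)
    have htmem : cornerParam t₂ (c 0) ∈ Ioc (0 : ℝ) t₁ := ⟨htpos, (htlt.le.trans ht₂le)⟩
    have hspos : 0 < κ * cornerParam t₂ (c 0) := mul_pos hκpos htpos
    have hslt : κ * cornerParam t₂ (c 0) < b₀ := by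
      have : κ * cornerParam t₂ (c 0) < κ * t₂ := mul_lt_mul_of_pos_left htlt hκpos
      linarith
    have hsoff : ∀ i, κ * cornerParam t₂ (c 0) ≠ g i (cornerParam t₂ (c 0)) := fun i ↦
      ray_ne_wall (hg i) (hg0 i) htpos
    exact hgood _ htmem _ hspos hslt hsoff
  -- GU: immersion and injectivity are gauge-borne
  obtain ⟨e'', F', hF', hF'0, hinj, himm, hadm', hgood'⟩ := hGU X e' H hH hHadm hHgood
  exact ⟨e'', F', hF', hF'0.trans hH0, hinj, himm, hadm', fun c hc ↦ hgood' c hc⟩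

end Summit.FinalStateConjecture.FinalStateConjecture.Cruxes.SettlingAlongCensoredKerrEnds.WallConeSectionsSplit

end
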